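import Summits.QuantumFields.BalabanUV.Beta.FP.PerfectPolarizationReflection
import Summits.QuantumFields.BalabanUV.Beta.FP.PerfectBubbleExpansion

/-!
# `BalabanUV.Beta.FP.HessKerReflectionSplit` — road «FP» for binder row D1, sub-row **H2-ASM-5a** (Kcov), module R3 layer a ([folklore]): the reflection covariance of the
# flipped resolvent Hessian kernel SPLIT INTO ITS TWO WORDS — the BUBBLE word needs only the first-order vertex letters (R1 at `W := 0`), the TADPOLE word is a separate,
# usually EXPLICIT (ultra-local) kernel whose covariance is checked directly; hence a second form of (Kcov) for `PiBF` whose second-order vertex socket is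
# `AxisReflectionCovariant (fun μ ν z => tadpole leg (W μ 0 ν (−z)))` instead of the termwise table law of R2a

HONEST DEPENDENCY (page 1, mandatory): continuum YM on T⁴ ⇐ BetaPertH ∧ nine spine estimates (0/9 proved); BetaPertH ⇐ (D1) ∧ (D4) ∧ CAP+tail;
G-an2-4 gates asym, D1 and NE2/3/4.  HONEST FRAMING (cell contract, verbatim): «discharging `BetaPertH` makes Bałaban's UV stability UNCONDITIONAL —
a real constructive-QFT result; it is NOT the continuum limit and NOT the Clay problem.»  THIS MODULE DISCHARGES NOTHING of the wall: [folklore] linearity bookkeeping over R1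
(`KernelReflectionBounded.axisReflectionCovariant_flip_hessKer_bdd` at the zero second-order family, `PerfectBubbleExpansion.hessKer_zero_W`) and R2a's sector wiring; 0 def, 0 `def … : Prop`, nothing cited, 0 sorry;
0∕4 row-D1 binders; NOT hasym, NOT D1, NOT BetaPertH, NOT continuum, NOT Clay.

ABSOLUTE RULE (cell charter, verbatim): «No internally-minted statement may enter as a cited fact. Every hypothesis is either kernel-proved in this package or a
verbatim quotation of a PUBLISHED theorem with page reference. The manuscript(s) under audit are NOT citable for their own disputed steps — they are the thing
under adjudication; programme-internal (2001/route/tribunal) claims are never citable.»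

WHY.  R2a's (Kcov) theorem asks the second-order tables to obey the TERMWISE reflection law `W μ (bondRefl α c μ y) ν (bondRefl α c ν y′) = (ε_μ ε_ν) • refK Φα (W μ y ν y′)`.
Contact tables attached to one endpoint of a bond (e.g. the typed ghost contact `D1BFx.GhostStencil.ghCnt`∕`Wgh`, supported at `u + e_κ′`) need NOT obey it at `κ′ = α`, while
their TADPOLE — a bond-diagonal ultra-local kernel `[μ = ν][z = 0]·const` — is covariant outright.  Since `hessKer A V W μ ν z = ½·tadpole A (W μ 0 ν z) − ½·bubble A (V μ 0) (V ν z)`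
and `AxisReflectionCovariant` is linear, the two words can be certified separately; this file provides the split and the bubble word from R1.
CONTENT: §1 `refK_zero`, `shiftK_zero`, `blockCovariant_zero₂` (the zero-family facts `tadpole_zero` ∕ `vertexFamily₂_zero` ∕ `hessKer_zero_W` are `StepDriftWitness`'s and leaf-02-g3's `PerfectBubbleExpansion`'s, BY NAME);
§2 **`axisReflectionCovariant_flip_bubbleKer_bdd`** (bounded leg, first-order letters only ⟹ `AxisReflectionCovariant (fun μ ν z => bubble A (V μ 0) (V ν (−z)))`);
§3 `axisReflectionCovariant_lincomb_dim`, `axisReflectionCovariant_flip_hessKer_of_words` (bubble word ∧ tadpole word ⟹ Hessian), **`axisReflectionCovariant_flip_hessKer_one_of_tadpoleKer`** (ONE SECTOR at `N = 1`: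
first-order letters + the tadpole word's covariance as a hypothesis), `axisReflectionCovariant_flip_of_bondDiagonal` (a word vanishing off `μ = ν ∧ z = 0` is covariant outright), **`axisReflectionCovariant_flip_tadpoleKer_of_bondDiagonal`** (the tadpole word of ANY bond-diagonal table over ANY leg); §4 **`axisReflectionCovariant_flip_PiBF_of_tadpoleKer`** ∕ **`axisReflectionCovariant_flipK_PiBF_of_tadpoleKer`**.
Provenance: D1 formalisation swarm seat b2b-balaban-beta-d1-formalise-leaf-02 gen 9 (road FP engine lineage; sub-row H2-ASM-5a (Kcov) REFLECTION HALF), 2026-08-21.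
-/

noncomputable section

namespace Summit.QuantumFields.BalabanUV.Beta.FP.HessKerReflectionSplit

open Finset
open scoped BigOperators
open Literature.MathematicalPhysics.QuantumFieldTheory.Balaban1983to89
open Literature.MathematicalPhysics.QuantumFieldTheory.Balaban1983to89.Beta
open B6BondElimination (unitVec)
open PolarizationSign (axisReflect reflSign AxisReflectionCovariant)
open ExpKernelCalculus (MKer Site BiLoc comp tr bubble tadpole hessKer VertexFamily VertexFamily₂ BlockCovariant shiftK)
open OneStepResolventKernel (Fib)
open OneStepKernelFamily (flipK flipK_apply)
open KernelWard (Bdd)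
open KernelReflection (LegMap refK refK_apply bondRefl)
open Summit.QuantumFields.BalabanUV.Beta.FP.PerfectPolarization (Pker G0ker PiBF PiBF_def Pker_translate G0ker_translate)
open Summit.QuantumFields.BalabanUV.Beta.FP.PerfectPolarizationWard (bdd_Pker bdd_G0ker blockCovariant_one)
open Summit.QuantumFields.BalabanUV.Beta.FP.KernelReflectionBounded (axisReflectionCovariant_flip_hessKer_bdd)
open Summit.QuantumFields.BalabanUV.Beta.FP.PerfectPolarizationReflection (axisReflectionCovariant_lincomb)
open StepDriftWitness (tadpole_zero)
open Summit.QuantumFields.BalabanUV.Beta.FP.PerfectBubbleExpansion (vertexFamily₂_zero hessKer_zero_W)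

variable {D : ℕ} {F : Type*} [Fintype F]

/-! ## §1 The zero second-order family (cf. `StepDriftWitness.tadpole_zero`, leaf-02-g3's `PerfectBubbleExpansion.vertexFamily₂_zero`∕`hessKer_zero_W`) -/

omit [Fintype F] in
/-- [folklore] relabelling the zero kernel gives zero. -/
theorem refK_zero (Φ : LegMap D F) : refK Φ (0 : MKer D F) = 0 := by
  funext x z a b
  simp [refK_apply]

omit [Fintype F] in
/-- [folklore] shifting the zero kernel gives zero. -/
theorem shiftK_zero (v : Site D) : shiftK v (0 : MKer D F) = 0 := rfl

omit [Fintype F] in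
/-- [folklore] block covariance with the zero second-order family from the leg's invariance and the first-order family's covariance. -/
theorem blockCovariant_zero₂ {A : MKer D F} {V : Fin D → Site D → MKer D F} {N : ℕ}
    (hA : ∀ t : Site D, shiftK (-((N : ℤ) • t)) A = A) (hV : ∀ (μ : Fin D) (y t : Site D), V μ (y + t) = shiftK (-((N : ℤ) • t)) (V μ y)) :
    BlockCovariant A V (0 : Fin D → Site D → Fin D → Site D → MKer D F) N where
  covA := hA
  covV := hV
  covW μ y ν y' t := by
    show (0 : MKer D F) = shiftK (-((N : ℤ) • t)) (0 : MKer D F)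
    rfl

/-! ## §2 The bubble word: first-order letters only -/

/-- [folklore] **THE BUBBLE WORD OF A BOUNDED LEG IS REFLECTION COVARIANT FROM THE FIRST-ORDER LETTERS ALONE**: bounded leg, first-order vertex family localised at the coarse
bonds, block-translation covariance, and for every axis `α` a leg relabelling `Φα` leaving the leg invariant under which the first-order family obeys the bond-reflection law ⟹
`AxisReflectionCovariant (fun μ ν z => bubble A (V μ 0) (V ν (−z)))` (R1 at the zero second-order family, rescaled by `−2`). -/
theorem axisReflectionCovariant_flip_bubbleKer_bdd {A : MKer D F} {V : Fin D → Site D → MKer D F} {B Cv δ : ℝ} {N : ℕ}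
    (hA : Bdd A B) (hV : VertexFamily V N Cv δ) (hδ : 0 < δ)
    (hcovA : ∀ t : Site D, shiftK (-((N : ℤ) • t)) A = A) (hcovV : ∀ (μ : Fin D) (y t : Site D), V μ (y + t) = shiftK (-((N : ℤ) • t)) (V μ y))
    (hrefl : ∀ α : Fin D, ∃ Φα : LegMap D F, refK Φα A = A ∧ ∃ c : ℤ, ∀ μ y, V μ (bondRefl α c μ y) = reflSign α μ • refK Φα (V μ y)) :
    AxisReflectionCovariant (fun μ ν z => bubble A (V μ 0) (V ν (-z))) := by
  have hrefl' : ∀ α : Fin D, ∃ Φα : LegMap D F, refK Φα A = A ∧ ∃ c : ℤ,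
      (∀ μ y, V μ (bondRefl α c μ y) = reflSign α μ • refK Φα (V μ y)) ∧
      (∀ μ y ν y', (0 : Fin D → Site D → Fin D → Site D → MKer D F) μ (bondRefl α c μ y) ν (bondRefl α c ν y')
        = (reflSign α μ * reflSign α ν) • refK Φα ((0 : Fin D → Site D → Fin D → Site D → MKer D F) μ y ν y')) := by
    intro α
    obtain ⟨Φα, hA', c, hVr⟩ := hrefl α
    refine ⟨Φα, hA', c, hVr, fun μ y ν y' => ?_⟩
    show (0 : MKer D F) = (reflSign α μ * reflSign α ν) • refK Φα (0 : MKer D F)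
    rw [refK_zero, smul_zero]
  have h := axisReflectionCovariant_flip_hessKer_bdd hA hV (vertexFamily₂_zero N δ) hδ (blockCovariant_zero₂ hcovA hcovV) hrefl'
  intro α μ ν z
  have h1 := h α μ ν z
  simp only [hessKer_zero_W] at h1
  show bubble A (V μ 0) (V ν (-(axisReflect α z - (if μ = α then unitVec α else 0) + (if ν = α then unitVec α else 0))))
    = reflSign α μ * reflSign α ν * bubble A (V μ 0) (V ν (-z))
  linear_combination (-2 : ℝ) * h1

/-! ## §3 The split: bubble word and tadpole word certified separately -/

/-- [folklore] the reflection-covariance predicate is linear, any dimension (`PerfectPolarizationReflection.axisReflectionCovariant_lincomb` is the `d = 4` instance). -/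
theorem axisReflectionCovariant_lincomb_dim {P Q : B12Beta.Kernel D} (hP : AxisReflectionCovariant P) (hQ : AxisReflectionCovariant Q) (a b : ℝ) :
    AxisReflectionCovariant (fun μ ν z => a * P μ ν z - b * Q μ ν z) := by
  intro α μ ν z
  have h1 := hP α μ ν z
  have h2 := hQ α μ ν z
  show a * P μ ν _ - b * Q μ ν _ = reflSign α μ * reflSign α ν * (a * P μ ν z - b * Q μ ν z)
  rw [h1, h2]
  ring

/-- [folklore] **THE SPLIT**: if the bubble word `z ↦ bubble A (V μ 0) (V ν (−z))` and the tadpole word `z ↦ tadpole A (W μ 0 ν (−z))` are both reflection covariant, so is the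
flipped resolvent Hessian kernel `z ↦ hessKer A V W μ ν (−z) = ½·tadpole − ½·bubble`. -/
theorem axisReflectionCovariant_flip_hessKer_of_words {A : MKer D F} {V : Fin D → Site D → MKer D F} {W : Fin D → Site D → Fin D → Site D → MKer D F}
    (hb : AxisReflectionCovariant (fun μ ν z => bubble A (V μ 0) (V ν (-z))))
    (ht : AxisReflectionCovariant (fun μ ν z => tadpole A (W μ 0 ν (-z)))) :
    AxisReflectionCovariant (fun μ ν z => hessKer A V W μ ν (-z)) := by
  have h := axisReflectionCovariant_lincomb_dim ht hb (1 / 2) (1 / 2)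
  intro α μ ν z
  exact h α μ ν z

/-- [folklore] **ONE SECTOR AT `N = 1`, TADPOLE WORD AS A HYPOTHESIS**: bounded translation-invariant leg; first-order vertex data bi-localised at the unit-lattice bonds, translation
covariant and obeying the bond-reflection law against a leg relabelling `Φα` leaving the leg invariant (every axis `α`); and the tadpole word of the second-order data reflection
covariant ⟹ `AxisReflectionCovariant (fun μ ν z => hessKer A V W μ ν (−z))`.  (Compare R2a's `axisReflectionCovariant_flip_hessKer_one`, whose second-order socket is the
termwise table law.) -/
theorem axisReflectionCovariant_flip_hessKer_one_of_tadpoleKer {Φ : Type*} [Fintype Φ] {A : MKer 4 Φ} {V : Fin 4 → Site 4 → MKer 4 Φ}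
    {W : Fin 4 → Site 4 → Fin 4 → Site 4 → MKer 4 Φ} {C Cv δ : ℝ}
    (hAb : Bdd A C) (hA : ∀ t : Site 4, shiftK t A = A)
    (hV : ∀ (μ : Fin 4) (y : Site 4), BiLoc (V μ y) y y Cv δ) (hcovV : ∀ (μ : Fin 4) (y t : Site 4), V μ (y + t) = shiftK (-t) (V μ y)) (hδ : 0 < δ)
    (hreflV : ∀ α : Fin 4, ∃ Φα : LegMap 4 Φ, refK Φα A = A ∧ ∃ c : ℤ, ∀ μ y, V μ (bondRefl α c μ y) = reflSign α μ • refK Φα (V μ y))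
    (htad : AxisReflectionCovariant (fun μ ν z => tadpole A (W μ 0 ν (-z)))) :
    AxisReflectionCovariant (fun μ ν z => hessKer A V W μ ν (-z)) := by
  have hV' : VertexFamily V 1 Cv δ := fun μ y => by simpa using hV μ y
  have hcovA : ∀ t : Site 4, shiftK (-(((1 : ℕ) : ℤ) • t)) A = A := fun t => by simpa using hA (-t)
  have hcovV' : ∀ (μ : Fin 4) (y t : Site 4), V μ (y + t) = shiftK (-(((1 : ℕ) : ℤ) • t)) (V μ y) := fun μ y t => by simpa using hcovV μ y t
  exact axisReflectionCovariant_flip_hessKer_of_words (axisReflectionCovariant_flip_bubbleKer_bdd hAb hV' hδ hcovA hcovV' hreflV) htad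

/-- [folklore] **A BOND-DIAGONAL ULTRA-LOCAL WORD IS REFLECTION COVARIANT OUTRIGHT**: if a two-index kernel `T μ ν z` vanishes unless `μ = ν ∧ z = 0` (the shape of the tadpole
word of a bond-diagonal contact table over a translation-invariant leg), then `AxisReflectionCovariant (fun μ ν z => T μ ν (−z))` — for `μ = ν` the two unit shifts of the
printed law cancel and only the origin reflects to the origin; for `μ ≠ ν` both sides vanish. -/
theorem axisReflectionCovariant_flip_of_bondDiagonal {T : Fin D → Fin D → Site D → ℝ} (hT : ∀ μ ν z, ¬(μ = ν ∧ z = 0) → T μ ν z = 0) :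
    AxisReflectionCovariant (fun μ ν z => T μ ν (-z)) := by
  intro α μ ν z
  show T μ ν (-(axisReflect α z - (if μ = α then unitVec α else 0) + (if ν = α then unitVec α else 0))) = reflSign α μ * reflSign α ν * T μ ν (-z)
  by_cases hμν : μ = ν
  · subst hμν
    rw [sub_add_cancel]
    have h1 : reflSign α μ * reflSign α μ = 1 := by unfold PolarizationSign.reflSign; split_ifs <;> norm_num
    by_cases hz : z = 0
    · subst hz
      have e0 : axisReflect α (0 : Site D) = 0 := by funext i; simp [PolarizationSign.axisReflect_apply]
      rw [e0]
      calc T μ μ (-0) = 1 * T μ μ (-0) := (one_mul _).symm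
        _ = reflSign α μ * reflSign α μ * T μ μ (-0) := by rw [h1]
    · have hz' : -axisReflect α z ≠ 0 := by
        intro h
        apply hz
        have h2 := congrArg (axisReflect α) (neg_eq_zero.mp h)
        rw [PolarizationSign.axisReflect_axisReflect] at h2
        rw [h2]; funext i; simp [PolarizationSign.axisReflect_apply]
      rw [hT μ μ _ (fun h => hz' h.2), hT μ μ _ (fun h => hz (neg_eq_zero.mp h.2)), mul_zero]
  · rw [hT μ ν _ (fun h => hμν h.1), hT μ ν _ (fun h => hμν h.1), mul_zero]

/-- [folklore] **THE TADPOLE WORD OF A BOND-DIAGONAL SECOND-ORDER FAMILY IS REFLECTION COVARIANT OVER ANY LEG**: if `W μ y ν y′ = 0` unless `μ = ν ∧ y = y′` (same-bond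
contact tables: the typed ghost family `D1BFx.GhostStencil.Wgh`, bond-diagonal quartic tables of the gluon sector), then `AxisReflectionCovariant (fun μ ν z => tadpole A (W μ 0 ν (−z)))`
with NO hypothesis on the leg `A` and NO termwise reflection law for `W`. -/
theorem axisReflectionCovariant_flip_tadpoleKer_of_bondDiagonal (A : MKer D F) {W : Fin D → Site D → Fin D → Site D → MKer D F}
    (hW : ∀ μ y ν y', ¬(μ = ν ∧ y = y') → W μ y ν y' = 0) :
    AxisReflectionCovariant (fun μ ν z => tadpole A (W μ 0 ν (-z))) := by
  refine axisReflectionCovariant_flip_of_bondDiagonal (T := fun μ ν z => tadpole A (W μ 0 ν z)) fun μ ν z h => ?_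
  show tadpole A (W μ 0 ν z) = 0
  rw [hW μ 0 ν z (fun h' => h ⟨h'.1, h'.2.symm⟩)]
  exact tadpole_zero A

/-! ## §4 The BF perfect polarization: first-order letters + the two tadpole words -/

/-- [our object] **(Kcov) FOR `PiBF`, SECOND FORM** — `AxisReflectionCovariant (fun μ ν z => PiBF wg wgh V W v w μ ν (−z))` for EVERY pair of colour weights, from: the
first-order data of both sectors bi-localised at the unit-lattice bonds, translation covariant and obeying the bond-reflection law against leg relabellings leaving `Pker` resp.
`G0ker` invariant ((L-REFL-P)∕(L-REFL-G) of `PerfectPropagatorReflection`), and the two TADPOLE WORDS `z ↦ tadpole Pker (W μ 0 ν (−z))`, `z ↦ tadpole G0ker (w μ 0 ν (−z))`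
reflection covariant (for bond-diagonal ultra-local tables an explicit `[μ = ν][z = 0]·const` — `FP/GhostJetReflection` discharges the ghost one for the typed contact table). -/
theorem axisReflectionCovariant_flip_PiBF_of_tadpoleKer (wg wgh : ℝ)
    {V : Fin 4 → Site 4 → MKer 4 (Fib 3)} {W : Fin 4 → Site 4 → Fin 4 → Site 4 → MKer 4 (Fib 3)}
    {v : Fin 4 → Site 4 → MKer 4 Unit} {w : Fin 4 → Site 4 → Fin 4 → Site 4 → MKer 4 Unit} {Cv Cv' δ : ℝ} (hδ : 0 < δ)
    (hV : ∀ (μ : Fin 4) (y : Site 4), BiLoc (V μ y) y y Cv δ) (hcovV : ∀ (μ : Fin 4) (y t : Site 4), V μ (y + t) = shiftK (-t) (V μ y))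
    (hreflV : ∀ α : Fin 4, ∃ Φα : LegMap 4 (Fib 3), refK Φα Pker = Pker ∧ ∃ c : ℤ, ∀ μ y, V μ (bondRefl α c μ y) = reflSign α μ • refK Φα (V μ y))
    (htadP : AxisReflectionCovariant (fun μ ν z => tadpole Pker (W μ 0 ν (-z))))
    (hv : ∀ (μ : Fin 4) (y : Site 4), BiLoc (v μ y) y y Cv' δ) (hcovv : ∀ (μ : Fin 4) (y t : Site 4), v μ (y + t) = shiftK (-t) (v μ y))
    (hreflv : ∀ α : Fin 4, ∃ Ψα : LegMap 4 Unit, refK Ψα G0ker = G0ker ∧ ∃ c : ℤ, ∀ μ y, v μ (bondRefl α c μ y) = reflSign α μ • refK Ψα (v μ y))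
    (htadG : AxisReflectionCovariant (fun μ ν z => tadpole G0ker (w μ 0 ν (-z)))) :
    AxisReflectionCovariant (fun μ ν z => PiBF wg wgh V W v w μ ν (-z)) := by
  have h1 := axisReflectionCovariant_flip_hessKer_one_of_tadpoleKer bdd_Pker Pker_translate hV hcovV hδ hreflV htadP
  have h2 := axisReflectionCovariant_flip_hessKer_one_of_tadpoleKer bdd_G0ker G0ker_translate hv hcovv hδ hreflv htadG
  have h := axisReflectionCovariant_lincomb h1 h2 wg wgh
  simpa only [PiBF_def] using h

/-- [our object] the same in the `flipK` spelling: **`AxisReflectionCovariant (flipK (PiBF wg wgh V W v w))`**. -/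
theorem axisReflectionCovariant_flipK_PiBF_of_tadpoleKer (wg wgh : ℝ)
    {V : Fin 4 → Site 4 → MKer 4 (Fib 3)} {W : Fin 4 → Site 4 → Fin 4 → Site 4 → MKer 4 (Fib 3)}
    {v : Fin 4 → Site 4 → MKer 4 Unit} {w : Fin 4 → Site 4 → Fin 4 → Site 4 → MKer 4 Unit} {Cv Cv' δ : ℝ} (hδ : 0 < δ)
    (hV : ∀ (μ : Fin 4) (y : Site 4), BiLoc (V μ y) y y Cv δ) (hcovV : ∀ (μ : Fin 4) (y t : Site 4), V μ (y + t) = shiftK (-t) (V μ y))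
    (hreflV : ∀ α : Fin 4, ∃ Φα : LegMap 4 (Fib 3), refK Φα Pker = Pker ∧ ∃ c : ℤ, ∀ μ y, V μ (bondRefl α c μ y) = reflSign α μ • refK Φα (V μ y))
    (htadP : AxisReflectionCovariant (fun μ ν z => tadpole Pker (W μ 0 ν (-z))))
    (hv : ∀ (μ : Fin 4) (y : Site 4), BiLoc (v μ y) y y Cv' δ) (hcovv : ∀ (μ : Fin 4) (y t : Site 4), v μ (y + t) = shiftK (-t) (v μ y))
    (hreflv : ∀ α : Fin 4, ∃ Ψα : LegMap 4 Unit, refK Ψα G0ker = G0ker ∧ ∃ c : ℤ, ∀ μ y, v μ (bondRefl α c μ y) = reflSign α μ • refK Ψα (v μ y))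
    (htadG : AxisReflectionCovariant (fun μ ν z => tadpole G0ker (w μ 0 ν (-z)))) :
    AxisReflectionCovariant (flipK (PiBF wg wgh V W v w)) :=
  axisReflectionCovariant_flip_PiBF_of_tadpoleKer wg wgh hδ hV hcovV hreflV htadP hv hcovv hreflv htadG

end Summit.QuantumFields.BalabanUV.Beta.FP.HessKerReflectionSplit

end
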